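import Summits.BirchSwinnertonDyer.BirchSwinnertonDyer.Theorems.ByReductionTypeAtTwoAdditiveSelmerTwistTransport
import HarnessLib

/-!
# Route ByReductionTypeAtTwo, crux C4″ `AdditivePotMultOverKAtTwo` (stmt-BirchSwinnertonDyer-22618) — R15's SELMER SIDE,
# sequel: the DOOR TRANSPORT at `2` (length bounds at height-one primes `𝔮 ∌ 2` move from `W₂ = W^{(2)}` to `W`)

Seat `bsd-2adic-t42` GEN 22 (cell `bsd-2adic`); sequel of `…AdditiveSelmerTwistTransport.lean` (same namespace
`…Theorems.AddSelmerTwistTwo`). HONEST FRAMING: THEOREMS ONLY; route-independent; closes no item; nothing booked; BSD is not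
proved by any of this.

* **`lengthAt_selmerDual_le_quotient_of_twist_model`** (+ `_inv`, `_of_isTopGenerator`, `_of_span_eq`) — if every dual Selmer
  datum `D₂` of `W₂` (key `g ∉ κ⁻¹(2ℤ₂)`) has `ℓ_𝔮(D₂.X) ≤ ℓ_𝔮(Λ/(b))` at every height-one `𝔮 ∌ 2`, then every dual Selmer
  datum `D` of `W` has `ℓ_𝔮(D.X) ≤ ℓ_𝔮(Λ/(Tw b))` at every height-one `𝔮 ∌ 2` (`Tw = unitTwistEquiv (−1)`, `T ↦ −T − 2`);
  with `(Tw b) = (L)` (the ANALYTIC half of R15, k4-w3) the conclusion is literally the (−2)-block door shape. So the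
  (−2)-block rows of C4″ consume the (−1)-block door at `W₂` plus these kernel theorems.

References: [Rubin2000] Ch. VI §1–§2; [GreenbergLNM1716] §4 p. 107.
-/

set_option autoImplicit false
-- the summit's namespace `Summit.BirchSwinnertonDyer.BirchSwinnertonDyer` (Sub = Summit) trips `dupNamespace`
set_option linter.dupNamespace false

noncomputable section

open scoped Classical

namespace Summit.BirchSwinnertonDyer.BirchSwinnertonDyer.Theorems.AddSelmerTwistTwo

open PowerSeries Field WeierstrassCurve Literature.NumberTheory.EllipticCurves
  Literature.NumberTheory.EllipticCurves.Module Literature.NumberTheory.EllipticCurves.PadicIntSeries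
  Literature.NumberTheory.EllipticCurves.QuadraticTwistSelmer Literature.NumberTheory.EllipticCurves.SelmerCharacterTwist

/-! ## §4 The door transport at `p = 2` -/

section Door

variable (κ : ZpExtension ℚ 2) (hκ : κ.IsCyclotomic) {g : absoluteGaloisGroup ℚ} (hg : g ∉ κ.layerSubgroup 1)
  (W W₂ : WeierstrassCurve ℚ) {V : VariableChange ℚ} (hV : V • W₂ = W.quadraticTwist 2)

include hκ hg hV in
/-- **DOOR TRANSPORT at `2`.** If every dual Selmer datum `D₂` of `W₂` (key `g`) satisfies `ℓ_𝔮(D₂.X) ≤ ℓ_𝔮(Λ/(b))` at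
every height-one prime `𝔮 ∌ 2`, then every dual Selmer datum `D` of `W` (key `g`) satisfies `ℓ_𝔮(D.X) ≤ ℓ_𝔮(Λ/(Tw b))`
at every height-one prime `𝔮 ∌ 2` (`Tw = unitTwistEquiv (−1)`, `T ↦ −T − 2`, permutes the height-one primes and fixes
`2`). With `W₂` in the (−1)-split-twist block of C4″ and the (−1)-block door's bound `b`, this is the Selmer half of
«the (−2)-block IS the (−1)-block at `W^{(2)}`» (R15); the analytic half `Tw b ↔` the `ωχ₂`-branch is k4-w3's.
[cite: Rubin2000, Ch. VI §1–§2] [cite: GreenbergLNM1716, §4 p. 107] -/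
theorem lengthAt_selmerDual_le_quotient_of_twist_model (b : IwasawaAlgebra 2)
    (h : ∀ (D₂ : W₂.SelmerDualData κ g) (𝔮 : PrimeSpectrum (IwasawaAlgebra 2)), 𝔮.asIdeal.height = 1 →
      PowerSeries.C (2 : ℤ_[2]) ∉ 𝔮.asIdeal →
        lengthAt (IwasawaAlgebra 2) D₂.X 𝔮 ≤ lengthAt (IwasawaAlgebra 2) (IwasawaAlgebra 2 ⧸ Ideal.span {b}) 𝔮)
    (D : W.SelmerDualData κ g) (𝔮 : PrimeSpectrum (IwasawaAlgebra 2)) (h𝔮 : 𝔮.asIdeal.height = 1)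
    (hp𝔮 : PowerSeries.C (2 : ℤ_[2]) ∉ 𝔮.asIdeal) :
    lengthAt (IwasawaAlgebra 2) D.X 𝔮 ≤
      lengthAt (IwasawaAlgebra 2)
        (IwasawaAlgebra 2 ⧸ Ideal.span {unitTwistEquiv (-1 : ℤ_[2]ˣ) norm_neg_one_sub_one_lt b}) 𝔮 := by
  obtain ⟨θ, hθ2, hθ1⟩ := exists_sqrt_two_fixed κ hκ
  obtain ⟨Ψ, hΨ, hconj⟩ := exists_subgroupH1_equiv_of_quadraticTwist_model κ W W₂ two_ne_zero hV hθ2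
    (smul_eq_of_mem_kerSubgroup κ hθ1)
  have hc : (((quadraticSign θ g : ℤ) : ℤ_[2])) = ((-1 : ℤ_[2]ˣ) : ℤ_[2]) := by
    rw [quadraticSign_eq_neg_one κ hθ2 hθ1 hg, intCast_neg_one_eq]
  have hp2 : ((2 : ℕ) : ℤ_[2]) = (2 : ℤ_[2]) := by norm_num
  have h' : ∀ (D₂ : W₂.SelmerDualData κ g) (𝔮 : PrimeSpectrum (IwasawaAlgebra 2)), 𝔮.asIdeal.height = 1 →
      (PowerSeries.C ((2 : ℕ) : ℤ_[2]) : IwasawaAlgebra 2) ∉ 𝔮.asIdeal →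
        lengthAt (IwasawaAlgebra 2) D₂.X 𝔮 ≤ lengthAt (IwasawaAlgebra 2) (IwasawaAlgebra 2 ⧸ Ideal.span {b}) 𝔮 :=
    fun D₂ 𝔮 h1 h2 ↦ h D₂ 𝔮 h1 (by rwa [hp2] at h2)
  exact lengthAt_le_quotient_of_charTwist (-1 : ℤ_[2]ˣ) norm_neg_one_sub_one_lt (quadraticSign θ g) hc Ψ hΨ
    (fun s' ↦ hconj g s') b h' D 𝔮 h𝔮 (by rwa [hp2])

include hκ hV in
/-- The key-`γ⁻¹` door transport (`γ` a topological generator; the PRINT-EXACT doors of addL2x GEN 16 / t42 GEN 21 key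
the dual datum to `γ⁻¹`). [cite: Rubin2000, Ch. VI §1–§2] -/
theorem lengthAt_selmerDual_le_quotient_of_twist_model_inv {γ : absoluteGaloisGroup ℚ} (hγ : κ.IsTopGenerator γ)
    (b : IwasawaAlgebra 2)
    (h : ∀ (D₂ : W₂.SelmerDualData κ γ⁻¹) (𝔮 : PrimeSpectrum (IwasawaAlgebra 2)), 𝔮.asIdeal.height = 1 →
      PowerSeries.C (2 : ℤ_[2]) ∉ 𝔮.asIdeal →
        lengthAt (IwasawaAlgebra 2) D₂.X 𝔮 ≤ lengthAt (IwasawaAlgebra 2) (IwasawaAlgebra 2 ⧸ Ideal.span {b}) 𝔮)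
    (D : W.SelmerDualData κ γ⁻¹) (𝔮 : PrimeSpectrum (IwasawaAlgebra 2)) (h𝔮 : 𝔮.asIdeal.height = 1)
    (hp𝔮 : PowerSeries.C (2 : ℤ_[2]) ∉ 𝔮.asIdeal) :
    lengthAt (IwasawaAlgebra 2) D.X 𝔮 ≤
      lengthAt (IwasawaAlgebra 2)
        (IwasawaAlgebra 2 ⧸ Ideal.span {unitTwistEquiv (-1 : ℤ_[2]ˣ) norm_neg_one_sub_one_lt b}) 𝔮 :=
  lengthAt_selmerDual_le_quotient_of_twist_model κ hκ (inv_not_mem_layerSubgroup_one_of_isTopGenerator κ hγ) W W₂ hV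
    b h D 𝔮 h𝔮 hp𝔮

include hκ hV in
/-- The key-`γ` door transport. [cite: Rubin2000, Ch. VI §1–§2] -/
theorem lengthAt_selmerDual_le_quotient_of_twist_model_of_isTopGenerator {γ : absoluteGaloisGroup ℚ}
    (hγ : κ.IsTopGenerator γ) (b : IwasawaAlgebra 2)
    (h : ∀ (D₂ : W₂.SelmerDualData κ γ) (𝔮 : PrimeSpectrum (IwasawaAlgebra 2)), 𝔮.asIdeal.height = 1 →
      PowerSeries.C (2 : ℤ_[2]) ∉ 𝔮.asIdeal →
        lengthAt (IwasawaAlgebra 2) D₂.X 𝔮 ≤ lengthAt (IwasawaAlgebra 2) (IwasawaAlgebra 2 ⧸ Ideal.span {b}) 𝔮)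
    (D : W.SelmerDualData κ γ) (𝔮 : PrimeSpectrum (IwasawaAlgebra 2)) (h𝔮 : 𝔮.asIdeal.height = 1)
    (hp𝔮 : PowerSeries.C (2 : ℤ_[2]) ∉ 𝔮.asIdeal) :
    lengthAt (IwasawaAlgebra 2) D.X 𝔮 ≤
      lengthAt (IwasawaAlgebra 2)
        (IwasawaAlgebra 2 ⧸ Ideal.span {unitTwistEquiv (-1 : ℤ_[2]ˣ) norm_neg_one_sub_one_lt b}) 𝔮 :=
  lengthAt_selmerDual_le_quotient_of_twist_model κ hκ (not_mem_layerSubgroup_one_of_isTopGenerator κ hγ) W W₂ hV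
    b h D 𝔮 h𝔮 hp𝔮

include hκ hg hV in
/-- **Door transport with the bound renamed**: if moreover `(Tw b) = (L)` as ideals (the ANALYTIC half of R15, k4-w3:
`Tw` of the `ω`-branch bound of `W₂` generates the same ideal as the `ωχ₂`-branch bound `L` of `W`), the conclusion reads
`ℓ_𝔮(D.X) ≤ ℓ_𝔮(Λ/(L))` — literally the shape of the (−2)-block doors. [cite: Rubin2000, Ch. VI §1–§2] -/
theorem lengthAt_selmerDual_le_quotient_of_twist_model_of_span_eq (b L : IwasawaAlgebra 2)
    (hspan : Ideal.span {unitTwistEquiv (-1 : ℤ_[2]ˣ) norm_neg_one_sub_one_lt b} = Ideal.span {L})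
    (h : ∀ (D₂ : W₂.SelmerDualData κ g) (𝔮 : PrimeSpectrum (IwasawaAlgebra 2)), 𝔮.asIdeal.height = 1 →
      PowerSeries.C (2 : ℤ_[2]) ∉ 𝔮.asIdeal →
        lengthAt (IwasawaAlgebra 2) D₂.X 𝔮 ≤ lengthAt (IwasawaAlgebra 2) (IwasawaAlgebra 2 ⧸ Ideal.span {b}) 𝔮)
    (D : W.SelmerDualData κ g) (𝔮 : PrimeSpectrum (IwasawaAlgebra 2)) (h𝔮 : 𝔮.asIdeal.height = 1)
    (hp𝔮 : PowerSeries.C (2 : ℤ_[2]) ∉ 𝔮.asIdeal) :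
    lengthAt (IwasawaAlgebra 2) D.X 𝔮 ≤ lengthAt (IwasawaAlgebra 2) (IwasawaAlgebra 2 ⧸ Ideal.span {L}) 𝔮 := by
  rw [← hspan]
  exact lengthAt_selmerDual_le_quotient_of_twist_model κ hκ hg W W₂ hV b h D 𝔮 h𝔮 hp𝔮

end Door

end Summit.BirchSwinnertonDyer.BirchSwinnertonDyer.Theorems.AddSelmerTwistTwo

end
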